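import Summits.BirchSwinnertonDyer.BirchSwinnertonDyer.Theorems.EisensteinPrimesMazurMCOnCellBTwistbackLamOnePartner
import Summits.BirchSwinnertonDyer.BirchSwinnertonDyer.Theorems.EisensteinPrimesMazurMCOnCellBTwistbackKLFieldSupplyAdmissible
import HarnessLib

/-!
# Crux 3 `MazurMCOnCellB` (stmt-BirchSwinnertonDyer-19033), line `twistback` v4 — road (d′) at `p = 3`, ASSEMBLED:
# stub 6 at a non-split X2b pair from the Nakagawa–Horie–Taya FIELD SUPPLY and ONE ∀-hypothesis — the twist-character
# DICTIONARY — with no analytic-rank input and no per-pair datum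

Width seat bsd-line-x2-p1-w5 (g0), 2026-08-28; composition of this seat's door p650387
(`…TwistbackLamOnePartner.upperPartner_at_of_klFlat_partner_of_thmE`) with width seat w6's field supply p651601
(`…TwistbackKLFieldSupplyAdmissible.exists_admissibleField_not_three_dvd_classNumber`). HONEST FRAMING (cell `bsd-eis`,
run/shared/lean/pub/bsd-eis/): a conditional theorem only. Named facts BY NAME: the route's `PublishedInputs`
(stmt-…-19037), Disegni 2020 Thm. 4(1), Greenberg–Vatsal Thm. (3.11)+(28), Dokchitser–Dokchitser 2010 Thm. 1.4
(`selmerCorank_mod_two_eq`), Nakagawa–Horie 1988 Thm. 1 + Taya 2000 (`nakagawaHorie_taya_exists_imaginary_h3_eq_one`) — all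
PUBLISHED — and Keller–Yin 2024 Thm. E multiplicative half (`thmE_pConverse_semistable_OPEN`, UNREFEREED PREPRINT; the
theorem is conditional on that OPEN claim; the line already carries Keller–Yin Thm. D, PRE). PLUS ONE ∀-HYPOTHESIS
`hDict` (the twist-character dictionary, NOT proved here: width seats w3 g8/g9, w7 and the LEAD are building it —
p648554, p649377, p650230, p649032, p650111, p650639, p651720, p645771). No `def`, no `sorry`; no main conjecture / BSD
proved for any curve unconditionally; 0 cells / labels / stubs / tiers move.

WHAT `hDict` SAYS (the exact remaining obligation of road (d′) at a non-split X2b pair `(W, 3)` with even character of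
fundamental discriminant `D > 0`): for EVERY imaginary quadratic `K` which is Heegner for `N_W`, `3` and `2`, with `d_K`
odd `< −4`, `d_K ≡ 1 (mod 24·N_W·D)`, `gcd(d_K, D) = 1`, `3 ∤ h(D·d_K)` and `4 < D·|d_K|`, every globally minimal model
`Wd` of `E^{(d_K)}` has a KL-FLAT CARRIER of LOCAL BALANCE `1` — a globally minimal `V′` `ℚ`-isogenous to `Wd` with a
ramified-even rational `3`-line, primitive characters `φ` (`3 ∣ m`), `ψ` (`3 ∤ d`), `S₀ ∌ 3` ⊇ bad places,
`‖L_∅(C,0)‖ = ‖L_∅(D,0)‖ = 1`, `1 + Σ_v δ = Σ_v s_v([φ(v)=v̄]+[ψ(v)=v̄])` (VERBATIM the `hKL` binder of p645525 §3).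
Granted `hDict`, stub 6's clause at `(W, 3)` follows with NO per-pair input: the field comes from print, the rank
from the certificate (p649897), the upper half from F1 + λ-minimality (p645419/p645525). So «balance 1 + dictionary»
is what separates the 30 balance-1 cells of row A10 (and every such pair) from stub 6, modulo KY Thm. D/E.

References: [NakagawaHorie1988] Thm. 1; [KrizLi2019] §9 (Thm. 9.4 first assertion); [GreenbergVatsal2000] §3 Thm. (3.11);
[Disegni2020] Thm. 4; [Wuthrich2014] Thm. 16; [DokchitserDokchitserAnnals2010] Thm. 1.4; [KellerYin2024] Thm. E (PRE).
-/

set_option autoImplicit false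

-- `Summit.BirchSwinnertonDyer.BirchSwinnertonDyer.…`: the summit and its single sub-problem share a name.
set_option linter.dupNamespace false

noncomputable section

open scoped Classical MatrixGroups ModularForm

open CongruenceSubgroup WeierstrassCurve NumberField IsDedekindDomain Field PowerSeries
  Literature.NumberTheory.EllipticCurves
  Literature.NumberTheory.GaloisRepresentations
  Literature.NumberTheory.EllipticCurves.ModularForms
  Literature.NumberTheory.QuadraticFields
  Literature.NumberTheory.EllipticCurves.KrizLi2019
  Literature.NumberTheory.EllipticCurves.Rank1Residual
  Literature.NumberTheory.EllipticCurves.Rank1Residual.Typed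
  Literature.NumberTheory.EllipticCurves.Wuthrich2014
  Literature.NumberTheory.EllipticCurves.GreenbergVatsal2000
  Literature.NumberTheory.EllipticCurves.Disegni2020
  Literature.NumberTheory.EllipticCurves.KellerYin2024
  Summit.BirchSwinnertonDyer.Rank1Residual
  Summit.BirchSwinnertonDyer.Rank1Residual.X2
  Summit.BirchSwinnertonDyer.BirchSwinnertonDyer.Theses
  Summit.BirchSwinnertonDyer.BirchSwinnertonDyer.Theorems.EisensteinPrimesLambdaFromCharacters
  Summit.BirchSwinnertonDyer.BirchSwinnertonDyer.Theorems.EisensteinPrimesMazurMCOnCellBTwistbackLamOnePartner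
  Summit.BirchSwinnertonDyer.BirchSwinnertonDyer.Theorems.EisensteinPrimesMazurMCOnCellBTwistbackKLFieldSupplyAdmissible

namespace Summit.BirchSwinnertonDyer.BirchSwinnertonDyer.Theorems.EisensteinPrimesMazurMCOnCellBTwistbackBalanceOneDoor

/-- **Stub 6 at a non-split X2b pair `(W, 3)` from the FIELD SUPPLY and the DICTIONARY, nothing per pair.** Data: `W/ℚ`
globally minimal with `X2.CellB W 3`, `3` NON-split; a positive fundamental discriminant `D` (that of the pair's even
character — its link to `W` is carried entirely by `hDict`); and `hDict`: for every admissible `K` produced by the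
Nakagawa–Horie–Taya supply (imaginary quadratic, Heegner for `N_W`, `3`, `2`; `d_K` odd `< −4`, `≡ 1 (mod 24·N_W·D)`,
coprime to `D`; `3 ∤ h(D·d_K)`; `4 < D·|d_K|`) and every globally minimal model `Wd` of `E^{(d_K)}`, a KL-flat carrier of
balance `1` (the `hKL` binder of p645525 §3, verbatim, at `p = 3`). Then the partner clause of `stub_upperPartner` holds
at `(W, 3)`: the field by p651601 (`hNH`), the clause by p650387 (rank from the `(0,1)` certificate via Kato–Wuthrich +
Dokchitser + Keller–Yin Thm. E; upper half via F1 + λ-minimality + Disegni). Inputs BY NAME: `PublishedInputs`,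
Disegni Thm. 4(1), GV Thm. (3.11), Dokchitser, Nakagawa–Horie–Taya (PUB); Keller–Yin Thm. E (PRE); `hDict`.
[claim: KellerYin2024, status: under-review] [cite: NakagawaHorie1988, Thm. 1] [cite: KrizLi2019, Thm. 9.4 (first assertion) (§9)]
[cite: GreenbergVatsal2000, §3 Thm. (3.11) (p. 43) and §2 p. 28] [cite: Disegni2020, Thm. 4 (§3.2)]
[cite: Wuthrich2014, Thm. 16 (p. 397)] [cite: DokchitserDokchitserAnnals2010, Thm. 1.4] -/
theorem upperPartner_at_three_of_dictionary_of_thmE (hP : EisensteinPrimes.PublishedInputs)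
    (hDis : padicBSD_rankOne_nonsplitMult) (h311 : thm311_hasUnitContent_iff_and_order_eq_of_lineRamifiedEven)
    (hDD : ∀ (V : WeierstrassCurve ℚ) [V.IsElliptic] (ℓ : ℕ) [Fact ℓ.Prime], selmerCorank_mod_two_eq V ℓ)
    (hKY : thmE_pConverse_semistable_OPEN)
    (hNH : Literature.NumberTheory.QuadraticFields.nakagawaHorie_taya_exists_imaginary_h3_eq_one)
    (W : WeierstrassCurve ℚ) [W.IsElliptic] [W.IsGloballyMinimal]
    (hc : X2.CellB W 3) (hns : ¬ W.HasSplitMultiplicativeReductionAtPrime 3)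
    {D : ℤ} (hD0 : 0 < D)
    (hDf : (D % 4 = 1 ∧ Squarefree D ∧ D ≠ 1) ∨ (4 ∣ D ∧ (D / 4 % 4 = 2 ∨ D / 4 % 4 = 3) ∧ Squarefree (D / 4)))
    (hDict : ∀ (K : Type) [Field K] [NumberField K], IsImaginaryQuadratic K →
      SatisfiesHeegnerHypothesis (W.conductorNorm ℤ) K → SatisfiesHeegnerHypothesis 3 K →
      SatisfiesHeegnerHypothesis 2 K → Odd (NumberField.discr K) → NumberField.discr K < -4 →
      NumberField.discr K ≡ 1 [ZMOD (24 * (W.conductorNorm ℤ : ℤ) * D)] → IsCoprime (NumberField.discr K) D →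
      ¬ 3 ∣ BinaryQuadraticForm.classNumber (D * NumberField.discr K) → 4 < (D * NumberField.discr K).natAbs →
      ∀ (Wd : WeierstrassCurve ℚ) [Wd.IsElliptic] [Wd.IsGloballyMinimal],
        (∃ C : VariableChange ℚ, C • Wd = W.quadraticTwist (NumberField.discr K : ℚ)) →
        ∃ (V' : WeierstrassCurve ℚ) (_ : V'.IsElliptic) (_ : V'.IsGloballyMinimal), IsIsogenous Wd V' ∧
          ∃ (S₀ : Finset (HeightOneSpectrum (𝓞 ℚ))) (Φ₀ : AddSubgroup (V'.geomTorsion ((3 : ℕ) : ℤ)))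
            (m : ℕ) (_ : NeZero m) (φ : DirichletCharacter (ZMod 3) m)
            (d : ℕ) (_ : NeZero d) (ψ : DirichletCharacter (ZMod 3) d),
            IsRationalLine V' 3 Φ₀ ∧ ¬ LineUnramifiedAt V' 3 Φ₀ ∧ LineEven V' 3 Φ₀ ∧
            φ.IsPrimitive ∧ ψ.IsPrimitive ∧ 3 ∣ m ∧ ¬ 3 ∣ d ∧
            (∀ (σ : absoluteGaloisGroup ℚ), ∀ Q ∈ Φ₀,
              σ • Q = (φ ((modNCyclotomicCharacter ℚ m σ : (ZMod m)ˣ) : ZMod m)).val • Q) ∧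
            (∀ (σ : absoluteGaloisGroup ℚ) (Q : V'.geomTorsion ((3 : ℕ) : ℤ)),
              σ • Q - (ψ ((modNCyclotomicCharacter ℚ d σ : (ZMod d)ˣ) : ZMod d)).val • Q ∈ Φ₀) ∧
            (∀ v ∈ S₀, (((3 : ℕ) : ℕ) : 𝓞 ℚ) ∉ v.asIdeal) ∧
            (∀ v : HeightOneSpectrum (𝓞 ℚ), v ∉ S₀ → (((3 : ℕ) : ℕ) : 𝓞 ℚ) ∉ v.asIdeal →
              V'.HasGoodReductionAt v) ∧
            ‖characterLValueC 3 φ ∅ 1‖ = 1 ∧ ‖characterLValueD 3 ψ ∅ 1‖ = 1 ∧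
            1 + ∑ v ∈ S₀, delta V' 3 v =
              ∑ v ∈ S₀, ((if φ (Rat.HeightOneSpectrum.natGenerator v : ZMod m) =
                    (Rat.HeightOneSpectrum.natGenerator v : ZMod 3)
                  then sFactor 3 (Rat.HeightOneSpectrum.natGenerator v) else 0) +
                (if ψ (Rat.HeightOneSpectrum.natGenerator v : ZMod d) =
                    (Rat.HeightOneSpectrum.natGenerator v : ZMod 3)
                  then sFactor 3 (Rat.HeightOneSpectrum.natGenerator v) else 0))) :
    ∃ (K : Type) (_ : Field K) (_ : NumberField K), IsImaginaryQuadratic K ∧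
      SatisfiesHeegnerHypothesis (W.conductorNorm ℤ) K ∧ SatisfiesHeegnerHypothesis 3 K ∧
      Odd (NumberField.discr K) ∧ NumberField.discr K < -4 ∧
      (W.quadraticTwist (NumberField.discr K : ℚ)).analyticRank = 1 ∧
      ∀ (Wd : WeierstrassCurve ℚ) [Wd.IsElliptic] [Wd.IsGloballyMinimal],
        (∃ C : VariableChange ℚ, C • Wd = W.quadraticTwist (NumberField.discr K : ℚ)) →
        MissingUpperBoundAt Wd 3 := by
  -- the admissible field from print
  obtain ⟨K, _, _, hK, hHN, hH3, hH2, hodd, hlt, hmod, hcop, -, h3, h4⟩ :=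
    EisensteinPrimesMazurMCOnCellBTwistbackKLFieldSupplyAdmissible.exists_admissibleField_not_three_dvd_classNumber hNH W
      hD0 hDf
  -- the door, with the carrier supplied by the dictionary at this `K`
  exact EisensteinPrimesMazurMCOnCellBTwistbackLamOnePartner.upperPartner_at_of_klFlat_partner_of_thmE hP hDis h311 hDD
    hKY W 3 hc hns K hK hHN hH3 hodd hlt
    (fun Wd _ _ hWd ↦ hDict K hK hHN hH3 hH2 hodd hlt hmod hcop h3 h4 Wd hWd)

end Summit.BirchSwinnertonDyer.BirchSwinnertonDyer.Theorems.EisensteinPrimesMazurMCOnCellBTwistbackBalanceOneDoor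

end
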